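import Literature.MathematicalPhysics.QuantumFieldTheory.Balaban1983to89.T4NestedLevels
import Literature.MathematicalPhysics.QuantumFieldTheory.Balaban1983to89.T4IndicatorShell

/-!
# T4NestedShells — flattening the threshold shells of ALL pending levels of one run into the top-level shell slot:
one-run flattening on nested ledgers and on the (2.20)-shaped chain of one-step operations, the non-circular form of
the inner shell-mass hypothesis, and the two packagings (RATE vs WEIGHT) of the same data for node U5's two-run
comparison, ending in the constructor of `T4IndicatorShell.ShellWeightBound` (cell `pub-balaban`, T4-DAG v5 §2 nodes
U5 / U5b / U5d, §6 NE7c, obligations O-c1 / O-c6 of `t4/T4-EST-U5Ec.md`; typing + bookkeeping only)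

HONEST FRAMING (T4-DAG PAGE 1).  The cell's T4 target is rung (B)+1: existence AND uniqueness of the ε → 0 limit of
Bałaban's unit-scale averaged loop expectations on a FIXED finite torus — strictly beyond ultraviolet stability
([Balaban1988Convergent] Cor. 3 p. 264; [Balaban1989LargeFieldII] Thm 1 p. 355), NOT infinite volume, NOT a mass gap, NOT
the Clay problem.  Node U5 compares, term by term, the final-scale density expansions of TWO runs of the renormalization
group driven by the SAME unit-lattice field.  NOTHING OF THIS COMPARISON IS PRINTED: the manuscripts under audit construct
ONE run and bound its terms uniformly in ε.  This module therefore ASSERTS NOTHING about Bałaban's objects; every shape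
below is a HYPOTHESIS node U5.E may assume, never a fact, and every `theorem` is [folklore] (order arithmetic in `ℝ≥0∞` /
`ℝ`, monotonicity of positive operations and of the integral, structural induction).  0 sorry.

WHAT IS AT STAKE (located by the tree, cell GAPS G-b01g8-3).  `T4NestedLevels` proved that a two-sided leafwise sandwich
between the two runs passes through any nesting of COMMON positive integral operations with bounds that add over the
leaves only.  Its price is obligation O-c1: every characteristic function inside a pending operation must be the IDENTICAL
function of the common configuration in both runs.  Where an inner small-field radius is run-dependent no leafwise order
exists between the two {0,1}-valued functions; the device (one level down, `T4NestedLevels.Sandwiched.of_shell`; at the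
top level, `T4IndicatorShell`) is to cut BOTH runs at a common CORE radius and to book each run's SHELL piece (the
configurations with the tested variable between the core radius and the run's own radius) as extra nonnegative mass of ITS
OWN run.  A term of the final density carries such shells at up to `N` pending levels at once ((2.20)/(1.71): the pending
operation of a large-field region is an ordered product of one-step operations, each with its own characteristic
functions).  This module kernel-checks the bookkeeping of that situation:
(§1) ONE-RUN FLATTENING ON NESTED LEDGERS: if, leaf by leaf, a run's CORE value and FULL value satisfy
  `core ≤ full ≤ e^{κ_i}·core` pointwise, then the root values satisfy `core ≤ full ≤ e^{Σ_leaves κ_i}·core` — once per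
  leaf, blind to the nesting depth (`eval_flatten`, a corollary of `T4NestedLevels.Ledger.sandwiched_eval` applied to ONE
  run with the two leaf assignments core / full; `eval_mono`).  This is the right granularity when a shell-bearing inner
  BLOCK (after its own pending integration) is booked as a leaf of the outer ledger.
(§2) THE CHAIN ((2.20)-shaped) AND THE NON-CIRCULAR PRIMITIVE: for a raw indicator leaf the upper bound
  `full ≤ e^{κ}·core` is false pointwise (the shell indicator is `1` where the core indicator is `0`); the relative shell
  mass exists only AFTER the level's own integration.  `chainVal` types a run's term as the ordered composition of one-step
  positive operations `T_k`, level `k` inserting an indicator `χ_k`, a common remaining factor `E_k` and the value of the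
  older levels; the inner shell-mass hypothesis (O-c6) is stated NON-circularly — the level-`k` FULL indicator integrated
  against the level-`k` factor and the CORE value of all older levels costs at most `e^{κ_k}` times the level-`k` CORE value
  — and `chain_flatten` proves `core_n ≤ full_n ≤ e^{Σ_{k<n} κ_k}·core_n` pointwise in the outer variables (`κ_k =
  log(1 + ω_k)` for a relative mass `ω_k`, `chain_flatten_relMass`; `Σ log(1+ω_k) ≤ Σ ω_k`).  The chain IS a sum-free
  nested ledger of `T4NestedLevels` (`chainLedger`, `eval_chainLedger`, `sumFree_chainLedger`), so the two-run matching
  of the CORES is `T4NestedLevels`' business unchanged.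
(§3) TWO PACKAGINGS OF THE SAME DATA for the two-run comparison (G-b01g8-3's dichotomy made quantitative).  RATE: cores
  sandwiched with `(lo, hi)` and each run flattened with log-mass `L_A`, `L_B` ⇒ the FULL values are sandwiched with
  `(lo − L_A, hi + L_B)` (`sandwiched_of_flattened`, the all-levels form of `Sandwiched.of_shell`; `twoRun_flatten_ledger`,
  `twoRun_flatten_chain`) — the shells are charged to the per-term remainder, undivided by the volume, but no weight
  condition is needed.  WEIGHT: after the final integration (`integral_flatten`) each term's weight satisfies
  `0 ≤ Xcore ≤ X ≤ e^{L}·Xcore`, hence its flattened shell `X − Xcore` obeys `0 ≤ X − Xcore ≤ (1 − e^{−L})·X`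
  (`shell_bounds_of_flattened`); summing over terms gives EXACTLY the fields of `T4IndicatorShell.ShellWeightBound` with
  `shX := X − Xcore` and `Wsh K := 1 − e^{−L_K} ≤ L_K` (`shellWeightBound_of_flattened`, summable when `L` is), and the
  `hcore` binder of `T4IndicatorShell.cauchy_of_relWeightBound_shell` (= the `core` field of `T4MatchingAssembly.HybridNE7`)
  becomes LITERALLY the sandwich of the cores (`hcore_of_cores`; end-to-end plug `cauchy_of_flattenedShells`).  The
  weight slot charges the flattened shell at least its log-mass: `−log(1 − W − Wsh) ≥ L − log(1 − W)` (`weightSlot_charge`;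
  equality `= L` without a bad class is the tree's `T4WeightBudgetKP.neg_log_one_sub_weightKP`), divided by `vol` in
  `T4HybridMatching.hybridDelta`, and requires `W + Wsh < 1`.
(§4) ADDITIVE (UNION-BOUND) PACKAGING (v1.1; the shape named by T4-DAG v6 row T4-U5.E-c-SHELL°): finitely many
  single-run shell bounds ADD — if every shell-bearing SLOT `s` (a pending level, or a slot of a level) carries its own
  `ShellWeightBound` with weight `Wsh_s` (its shell piece cut with ALL OTHER slots FULL: a piece of the full run, single-run
  species, no circularity) and the total shell part is termwise at most the sum of the slot pieces (the union bound:
  «some slot in its shell» ⊆ ⋃_s «slot s in its shell»; at indicator level this is `T4IndicatorShell.sum_shell_le_prod` /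
  `prod_eq_core_add_sum_shell`), then the total is a `ShellWeightBound` with weight `Σ_s Wsh_s` (`shellWeightBound_add`,
  `shellWeightBound_of_nestedShells`), = `Σ_ℓ m_ℓ·Wsh_ℓ` when the slots are grouped by level with flattened multiplicities
  `m_ℓ` (`sum_slots_by_level`, `shellWeightBound_of_levels`).  Overlaps of the slot shells with each other or with the bad
  class are OVER-counted, never under-counted (the hybrid kernel charges `W + Wsh`): a sum is always valid, a max would only
  be sharper.  Compared with §2–§3 (multiplicative flattening, `Wsh = 1 − e^{−Σκ} ≤ Σ κ`), the additive form asks each slot's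
  mass against the run's FULL total — the NE7c species verbatim, once per slot.

Printed context (verbatim, read on the ×2 journal-page renders by this seat's lineage, cell GAPS C-b01g8-1, cross-read
REFEREE6 E65; the manuscripts under audit are quoted for CONTEXT AND SHAPE only — no disputed step of theirs is used).
* THE CHAIN.  [Balaban1988Convergent] p. 258: *"For a given large field region X the operation 𝐓_k(X) can be factorized
  into a product of one-step operations, and has the form 𝐓_k(X) = Π_{j=k−1}^{0} 𝐓^{(j)}(Z_{j+1} ∩ X). (2.20) This is an
  ordered product, the order indicated in the product symbol."*; *"If the operation 𝐓^{(j)} is changed by an 𝐑-operation,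
  then the general form (2.21) is preserved, but the characteristic functions are changed"*.
  [Balaban1988Convergent, (2.20)–(2.21) p.258]
* POSITIVITY OF THE PENDING OPERATIONS (the two properties `PosOp` keeps).  [Balaban1989LargeFieldII] pp. 379–380: *"All
  the expressions in the definition (1.71), for the configuration U, are real, and the exponential density in the integral
  is positive. This implies the inequalities"* (1.73).  [Balaban1989LargeFieldII, (1.73) p.380]
* WHAT PRINT OFFERS AT AN INNER THRESHOLD (one run, a small factor — not a two-run shell mass).  [Balaban1989LargeFieldII]
  p. 383: *"This is the largest factor among all the small factors we have obtained from the large field characteristic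
  functions in the preparatory steps. We assume that 2p₁ − (d+5)r₀ > p₀, and we estimate the factors by exp(−p₀(g_j))."*;
  *"All the integrals with respect to the group valued variables in the definition (1.71) are estimated by 1."*
  [Balaban1989LargeFieldII, p.383]

Deliberately NOT here: any statement about Bałaban's densities, operations, characteristic functions or histories; the
shell masses `ω_k` / log-masses `κ_k`, `L_K` themselves (NOT PRINTED — p. 383 gives at a threshold only the single-run
small factor it extracts there; their derivation is the [analysis] of rows T4-U5b.E2 / T4-U5.E-a, template
[Balaban1989LargeFieldI] p. 193 as recorded in `T4IndicatorShell`); the two-run matching of the cores (`T4NestedLevels`,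
`T4RecentScale`); the bad-class weights (`T4WeightBudget.RelWeightBound`); integrability / finiteness (hypotheses below).
Value = typed hypothesis shapes with exact quantifier order + kernel bookkeeping of an implication ⇐ named inputs; NOT
summit progress.  Cell GAPS C-b01g9-1, G-b01g9-1…; unit b2b-balaban-b01-g9 (journal row T4-U5.E-c-SHELL°).
-/

noncomputable section

open scoped BigOperators ENNReal
open _root_.MeasureTheory Finset

namespace Literature.MathematicalPhysics.QuantumFieldTheory.Balaban1983to89.T4NestedShells

open T4NestedLevels T4HybridMatching T4CauchySum T4WeightBudget T4IndicatorShell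

/-! ## §0 The one-run flattened-shell relation is `Sandwiched 0 L core full` -/

section Flat

variable {L : ℝ} {a₀ a : ℝ≥0∞}

/-- CONSTRUCTOR: `core ≤ full ≤ e^{L}·core` is `Sandwiched 0 L core full` (the relation of `T4NestedLevels` with lower
log-bound `0`, read inside ONE run between its core value and its full value). [folklore] -/
theorem flat_of (h₁ : a₀ ≤ a) (h₂ : a ≤ ENNReal.ofReal (Real.exp L) * a₀) : Sandwiched 0 L a₀ a :=
  ⟨by simpa only [Real.exp_zero, ENNReal.ofReal_one, one_mul] using h₁, h₂⟩

/-- PROJECTION: the core never exceeds the full value. [folklore] -/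
theorem le_of_flat (h : Sandwiched 0 L a₀ a) : a₀ ≤ a := by
  simpa only [Real.exp_zero, ENNReal.ofReal_one, one_mul] using h.1

/-- PROJECTION: the full value is at most `e^{L}` times the core. [folklore] -/
theorem le_exp_mul_of_flat (h : Sandwiched 0 L a₀ a) : a ≤ ENNReal.ofReal (Real.exp L) * a₀ := h.2

/-- Composing two flattenings (core ≤ middle ≤ e^{L₁} core, middle ≤ full ≤ e^{L₂} middle): log-masses ADD. [folklore] -/
theorem flat_trans {L₁ L₂ : ℝ} {a₁ : ℝ≥0∞} (h₁ : Sandwiched 0 L₁ a₀ a₁) (h₂ : Sandwiched 0 L₂ a₁ a) :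
    Sandwiched 0 (L₁ + L₂) a₀ a := by
  refine flat_of ((le_of_flat h₁).trans (le_of_flat h₂)) ?_
  calc a ≤ ENNReal.ofReal (Real.exp L₂) * a₁ := h₂.2
    _ ≤ ENNReal.ofReal (Real.exp L₂) * (ENNReal.ofReal (Real.exp L₁) * a₀) := mul_le_mul' le_rfl h₁.2
    _ = ENNReal.ofReal (Real.exp (L₁ + L₂)) * a₀ := by
        rw [← mul_assoc, ← ENNReal.ofReal_mul (Real.exp_nonneg _), ← Real.exp_add, add_comm L₂ L₁]

end Flat

/-! ## §1 One-run flattening on nested ledgers (block-leaf granularity) -/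

section LedgerFlatten

variable {ι O W : Type*} (T : O → PosOp W)

/-- ONE-RUN MONOTONICITY of the nested evaluation in the leaf values: products, finite sums and positive integral
operations are monotone. [folklore] -/
theorem eval_mono {g f : ι → W → ℝ≥0∞} (h : ∀ i w, g i w ≤ f i w) :
    ∀ (t : Ledger ι O) (w : W), Ledger.eval T g t w ≤ Ledger.eval T f t w
  | .leaf i, w => h i w
  | .mul s t, w => mul_le_mul' (eval_mono h s w) (eval_mono h t w)
  | .add s t, w => add_le_add (eval_mono h s w) (eval_mono h t w)
  | .app o t, w => (T o).mono (fun w' => eval_mono h t w') w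

/-- If EVERY leaf is sandwiched at every configuration, the ledger is `Matched` everywhere (the vanishing device of
`T4NestedLevels.Ledger.Matched` at product nodes is simply not used). [folklore] -/
theorem matched_of_leaves {fA fB : ι → W → ℝ≥0∞} {l u : ι → ℝ}
    (h : ∀ i w, Sandwiched (l i) (u i) (fA i w) (fB i w)) :
    ∀ (t : Ledger ι O) (w : W), Ledger.Matched T fA fB l u t w
  | .leaf i, w => h i w
  | .mul s t, w => Or.inl ⟨matched_of_leaves h s w, matched_of_leaves h t w⟩
  | .add s t, w => ⟨matched_of_leaves h s w, matched_of_leaves h t w⟩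
  | .app _ t, _ => fun w' => matched_of_leaves h t w'

/-- With all leaf lower log-bounds `0` the computed root lower bound is `0`. [folklore] -/
theorem lower_const_zero : ∀ t : Ledger ι O, Ledger.lower (fun _ : ι => (0 : ℝ)) t = 0
  | .leaf _ => rfl
  | .mul s t => by simp only [Ledger.lower, lower_const_zero s, lower_const_zero t, add_zero]
  | .add s t => by simp only [Ledger.lower, lower_const_zero s, lower_const_zero t, min_self]
  | .app _ t => lower_const_zero t

/-- **ONE-RUN FLATTENING ON A NESTED LEDGER.**  One run, two leaf assignments of the SAME ledger: `g` (every
shell-bearing block cut at its core radius) and `f` (full).  If leaf by leaf `g_i ≤ f_i ≤ e^{κ_i}·g_i` pointwise with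
`0 ≤ κ_i` (`κ_i = 0` at leaves carrying no shell), then at the ROOT `core ≤ full ≤ e^{Σ_leaves κ_i}·core` at every
configuration — the shells of ALL levels flatten to ONE relative bound whose log-mass is the leaf sum, with no factor for
the nesting depth (`T4NestedLevels.Ledger.sandwiched_eval` + `upper_le_leafSum`, read inside one run). [folklore] -/
theorem eval_flatten {g f : ι → W → ℝ≥0∞} {κ : ι → ℝ} (hκ : ∀ i, 0 ≤ κ i)
    (h : ∀ i w, Sandwiched 0 (κ i) (g i w) (f i w)) (t : Ledger ι O) (w : W) :
    Sandwiched 0 (t.leafSum κ) (Ledger.eval T g t w) (Ledger.eval T f t w) := by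
  have h1 := Ledger.sandwiched_eval T g f (fun _ => (0 : ℝ)) κ t w (matched_of_leaves T h t w)
  rw [lower_const_zero] at h1
  exact h1.mono le_rfl (Ledger.upper_le_leafSum κ hκ t).1

/-- Sum-free ledgers (one sub-history chain): the flattened log-mass is EXACTLY the leaf sum, no sign condition.
[folklore] -/
theorem eval_flatten_sumFree {g f : ι → W → ℝ≥0∞} {κ : ι → ℝ} {t : Ledger ι O} (hfree : t.SumFree)
    (h : ∀ i w, Sandwiched 0 (κ i) (g i w) (f i w)) (w : W) :
    Sandwiched 0 (t.leafSum κ) (Ledger.eval T g t w) (Ledger.eval T f t w) := by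
  have h1 := Ledger.sandwiched_eval T g f (fun _ => (0 : ℝ)) κ t w (matched_of_leaves T h t w)
  rwa [lower_const_zero, Ledger.upper_eq_leafSum κ t hfree] at h1

end LedgerFlatten

/-! ## §2 The chain of one-step operations with a threshold shell at every pending level -/

section Chain

variable {W : Type*}

/-- THE CHAIN ((2.20)-shaped; a typed shape, NOT Bałaban's operation): level `k` applies the one-step positive operation
`Tk k` to the product of an inserted nonnegative factor `χ k` (the level's characteristic function — core OR full), a
remaining nonnegative factor `E k` (everything else the level inserts, the SAME in the core and the full reading of one
run) and the value of the older levels; `b` = the innermost block.  `chainVal Tk χ E b n` = the value after `n` levels, a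
function of the outer configuration. [cite: Balaban1988Convergent, (2.20) p.258 (shape of the ordered product only)] -/
def chainVal (Tk : ℕ → PosOp W) (χ E : ℕ → W → ℝ≥0∞) (b : W → ℝ≥0∞) : ℕ → W → ℝ≥0∞
  | 0 => b
  | k + 1 => (Tk k).op fun w => χ k w * E k w * chainVal Tk χ E b k w

/-- No level applied: the innermost block. [folklore] -/
@[simp] theorem chainVal_zero (Tk : ℕ → PosOp W) (χ E : ℕ → W → ℝ≥0∞) (b : W → ℝ≥0∞) :
    chainVal Tk χ E b 0 = b := rfl

/-- One more level. [folklore] -/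
theorem chainVal_succ (Tk : ℕ → PosOp W) (χ E : ℕ → W → ℝ≥0∞) (b : W → ℝ≥0∞) (k : ℕ) :
    chainVal Tk χ E b (k + 1) = (Tk k).op (fun w => χ k w * E k w * chainVal Tk χ E b k w) := rfl

/-- **CHAIN FLATTENING (the inner shell-mass hypothesis in NON-CIRCULAR form).**  One run; core indicators `χc k ≤ χf k`
full indicators (pointwise — true for nested thresholds, the shell being the difference); THE PRIMITIVE (obligation O-c6
of `t4/T4-EST-U5Ec.md`, NOT PRINTED): at each level `k < n`, the level-`k` operation applied to the FULL indicator times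
the level's factor times the CORE value of all older levels is at most `e^{κ_k}` times the level-`(k+1)` CORE value —
i.e. the level-`k` shell has relative mass `≤ e^{κ_k} − 1` measured with every older level at its core.  CONCLUSION: after
`n` levels `core_n ≤ full_n ≤ e^{Σ_{k<n} κ_k}·core_n` at every outer configuration — the shells of all levels flatten,
log-masses adding ONCE per level. [folklore] -/
theorem chain_flatten (Tk : ℕ → PosOp W) {χc χf E : ℕ → W → ℝ≥0∞} {b : W → ℝ≥0∞} {κ : ℕ → ℝ} :
    ∀ n : ℕ, (∀ k < n, ∀ w, χc k w ≤ χf k w) →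
      (∀ k < n, ∀ w, (Tk k).op (fun w => χf k w * E k w * chainVal Tk χc E b k w) w ≤
          ENNReal.ofReal (Real.exp (κ k)) * chainVal Tk χc E b (k + 1) w) →
      ∀ w, Sandwiched 0 (∑ k ∈ range n, κ k) (chainVal Tk χc E b n w) (chainVal Tk χf E b n w)
  | 0, _, _, w => by simpa using Sandwiched.rfl_of le_rfl le_rfl (b w)
  | n + 1, hχ, hκ, w => by
      have IH := chain_flatten Tk n (fun k hk => hχ k (Nat.lt_succ_of_lt hk))
        (fun k hk => hκ k (Nat.lt_succ_of_lt hk))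
      have hPtop : ENNReal.ofReal (Real.exp (∑ k ∈ range n, κ k)) ≠ ∞ := ENNReal.ofReal_ne_top
      refine flat_of ?_ ?_
      · rw [chainVal_succ, chainVal_succ]
        exact (Tk n).mono
          (fun w' => mul_le_mul' (mul_le_mul' (hχ n n.lt_succ_self w') le_rfl) (le_of_flat (IH w'))) w
      · have h1 : (Tk n).op (fun w => χf n w * E n w * chainVal Tk χf E b n w) w ≤
            (Tk n).op (fun w => ENNReal.ofReal (Real.exp (∑ k ∈ range n, κ k)) *
              (χf n w * E n w * chainVal Tk χc E b n w)) w :=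
          (Tk n).mono (fun w' => by
            calc χf n w' * E n w' * chainVal Tk χf E b n w'
                ≤ χf n w' * E n w' * (ENNReal.ofReal (Real.exp (∑ k ∈ range n, κ k)) *
                    chainVal Tk χc E b n w') := mul_le_mul' le_rfl (IH w').2
              _ = ENNReal.ofReal (Real.exp (∑ k ∈ range n, κ k)) *
                    (χf n w' * E n w' * chainVal Tk χc E b n w') := by ring) w
        rw [(Tk n).smul _ hPtop] at h1
        calc chainVal Tk χf E b (n + 1) w
            = (Tk n).op (fun w => χf n w * E n w * chainVal Tk χf E b n w) w := rfl
          _ ≤ ENNReal.ofReal (Real.exp (∑ k ∈ range n, κ k)) *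
                (Tk n).op (fun w => χf n w * E n w * chainVal Tk χc E b n w) w := h1
          _ ≤ ENNReal.ofReal (Real.exp (∑ k ∈ range n, κ k)) *
                (ENNReal.ofReal (Real.exp (κ n)) * chainVal Tk χc E b (n + 1) w) :=
              mul_le_mul' le_rfl (hκ n n.lt_succ_self w)
          _ = ENNReal.ofReal (Real.exp (∑ k ∈ range (n + 1), κ k)) * chainVal Tk χc E b (n + 1) w := by
              rw [← mul_assoc, ← ENNReal.ofReal_mul (Real.exp_nonneg _), ← Real.exp_add, sum_range_succ]

/-- RELATIVE-MASS FORM of the primitive: a shell mass `≤ ω_k ×` core (`0 ≤ ω_k`) at level `k` is the log-mass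
`κ_k = log(1 + ω_k)`, and the flattened log-mass is at most `Σ_{k<n} ω_k`. [folklore] -/
theorem chain_flatten_relMass (Tk : ℕ → PosOp W) {χc χf E : ℕ → W → ℝ≥0∞} {b : W → ℝ≥0∞} {ω : ℕ → ℝ} {n : ℕ}
    (hχ : ∀ k < n, ∀ w, χc k w ≤ χf k w) (hω : ∀ k < n, 0 ≤ ω k)
    (hmass : ∀ k < n, ∀ w, (Tk k).op (fun w => χf k w * E k w * chainVal Tk χc E b k w) w ≤
      ENNReal.ofReal (1 + ω k) * chainVal Tk χc E b (k + 1) w) (w : W) :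
    Sandwiched 0 (∑ k ∈ range n, ω k) (chainVal Tk χc E b n w) (chainVal Tk χf E b n w) := by
  have h := chain_flatten Tk (κ := fun k => Real.log (1 + ω k)) n hχ (fun k hk w' => by
    have h1 : 0 < 1 + ω k := by linarith [hω k hk]
    show _ ≤ ENNReal.ofReal (Real.exp (Real.log (1 + ω k))) * _
    rw [Real.exp_log h1]
    exact hmass k hk w') w
  refine h.mono le_rfl (sum_le_sum fun k hk => ?_)
  have hk' := hω k (mem_range.mp hk)
  have h1 : 0 < 1 + ω k := by linarith
  have h2 := Real.log_le_sub_one_of_pos h1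
  show Real.log (1 + ω k) ≤ ω k
  linarith

/-! ### The chain is a sum-free nested ledger of `T4NestedLevels` -/

/-- Leaf labels of the chain ledger: `inl k` = the indicator of level `k`, `inr (inl k)` = the remaining factor of level
`k`, `inr (inr ())` = the innermost block. [folklore] -/
def chainLeafVal (χ E : ℕ → W → ℝ≥0∞) (b : W → ℝ≥0∞) : ℕ ⊕ (ℕ ⊕ Unit) → W → ℝ≥0∞
  | Sum.inl k => χ k
  | Sum.inr (Sum.inl k) => E k
  | Sum.inr (Sum.inr _) => b

/-- The chain as a nested ledger: `app n (mul (mul (leaf χ_n) (leaf E_n)) (older levels))`, operations labelled by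
their level. [folklore] -/
def chainLedger : ℕ → Ledger (ℕ ⊕ (ℕ ⊕ Unit)) ℕ
  | 0 => Ledger.leaf (Sum.inr (Sum.inr ()))
  | k + 1 => Ledger.app k (Ledger.mul (Ledger.mul (Ledger.leaf (Sum.inl k)) (Ledger.leaf (Sum.inr (Sum.inl k))))
      (chainLedger k))

/-- The chain ledger is sum-free (ONE sub-history chain; the sums over sub-histories of (1.71) are `add` nodes of the
general ledgers of §1). [folklore] -/
theorem sumFree_chainLedger : ∀ n : ℕ, (chainLedger n).SumFree
  | 0 => trivial
  | k + 1 => ⟨⟨trivial, trivial⟩, sumFree_chainLedger k⟩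

/-- `chainVal` IS the `T4NestedLevels` evaluation of the chain ledger (so the two-run matching of the CORES of a chain is
`T4NestedLevels.Ledger.sandwiched_eval` on `chainLedger`, unchanged). [folklore] -/
theorem eval_chainLedger (Tk : ℕ → PosOp W) (χ E : ℕ → W → ℝ≥0∞) (b : W → ℝ≥0∞) :
    ∀ n : ℕ, Ledger.eval Tk (chainLeafVal χ E b) (chainLedger n) = chainVal Tk χ E b n
  | 0 => rfl
  | k + 1 => by
      show (Tk k).op _ = (Tk k).op _
      rw [← eval_chainLedger Tk χ E b k]
      rfl

end Chain

/-! ## §3 Two packagings of the same data: RATE (widen the two-run sandwich) vs WEIGHT (the top-level shell slot) -/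

section Rate

variable {lo hi LA LB : ℝ} {a₀ b₀ a b : ℝ≥0∞}

/-- **RATE PACKAGING** (the all-levels form of `T4NestedLevels.Sandwiched.of_shell`): the two runs' CORES sandwiched with
`(lo, hi)`, run A flattened with log-mass `L_A`, run B with `L_B` ⇒ the FULL values are sandwiched with
`(lo − L_A, hi + L_B)`.  The shells are charged to the per-term remainder (which the hybrid lemma wants `≤ vol·δ_K`);
no weight condition is needed. [folklore] -/
theorem sandwiched_of_flattened (h : Sandwiched lo hi a₀ b₀) (hA : Sandwiched 0 LA a₀ a) (hB : Sandwiched 0 LB b₀ b) :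
    Sandwiched (lo - LA) (hi + LB) a b := by
  constructor
  · calc ENNReal.ofReal (Real.exp (lo - LA)) * a
        ≤ ENNReal.ofReal (Real.exp (lo - LA)) * (ENNReal.ofReal (Real.exp LA) * a₀) := mul_le_mul' le_rfl hA.2
      _ = ENNReal.ofReal (Real.exp lo) * a₀ := by
          rw [← mul_assoc, ← ENNReal.ofReal_mul (Real.exp_nonneg _), ← Real.exp_add, sub_add_cancel]
      _ ≤ b₀ := h.1
      _ ≤ b := le_of_flat hB
  · calc b ≤ ENNReal.ofReal (Real.exp LB) * b₀ := hB.2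
      _ ≤ ENNReal.ofReal (Real.exp LB) * (ENNReal.ofReal (Real.exp hi) * a₀) := mul_le_mul' le_rfl h.2
      _ = ENNReal.ofReal (Real.exp (hi + LB)) * a₀ := by
          rw [← mul_assoc, ← ENNReal.ofReal_mul (Real.exp_nonneg _), ← Real.exp_add, add_comm LB hi]
      _ ≤ ENNReal.ofReal (Real.exp (hi + LB)) * a := mul_le_mul' le_rfl (le_of_flat hA)

/-- RATE PACKAGING ON NESTED LEDGERS, end to end: the two runs' CORE leaf values matched everywhere with leaf bounds
`(l, u)` on a common nesting of operations, each run's full leaf values flattening onto its cores with leaf log-masses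
`κA`, `κB ≥ 0` ⇒ the FULL root values are sandwiched with `(lower l − Σ κA, upper u + Σ κB)`. [folklore] -/
theorem twoRun_flatten_ledger {ι O W : Type*} (T : O → PosOp W) {gA fA gB fB : ι → W → ℝ≥0∞} {l u κA κB : ι → ℝ}
    (hκA : ∀ i, 0 ≤ κA i) (hκB : ∀ i, 0 ≤ κB i)
    (hA : ∀ i w, Sandwiched 0 (κA i) (gA i w) (fA i w)) (hB : ∀ i w, Sandwiched 0 (κB i) (gB i w) (fB i w))
    (t : Ledger ι O) (w : W) (hM : Ledger.Matched T gA gB l u t w) :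
    Sandwiched (t.lower l - t.leafSum κA) (t.upper u + t.leafSum κB)
      (Ledger.eval T fA t w) (Ledger.eval T fB t w) :=
  sandwiched_of_flattened (Ledger.sandwiched_eval T gA gB l u t w hM) (eval_flatten T hκA hA t w)
    (eval_flatten T hκB hB t w)

/-- RATE PACKAGING ON CHAINS, end to end: cores of the two runs' chains sandwiched with `(lo, hi)` after `n` levels (from
`T4NestedLevels` on `chainLedger`, or any other source), each run's chain flattened by `chain_flatten` ⇒ the full chain
values are sandwiched with `(lo − Σ_{k<n} κA_k, hi + Σ_{k<n} κB_k)`.  The two runs may even carry different one-step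
operations here: flattening is a ONE-run affair. [folklore] -/
theorem twoRun_flatten_chain {W : Type*} {TkA TkB : ℕ → PosOp W} {χcA χfA EA χcB χfB EB : ℕ → W → ℝ≥0∞}
    {bA bB : W → ℝ≥0∞} {κA κB : ℕ → ℝ} {n : ℕ} {w : W}
    (hcore : Sandwiched lo hi (chainVal TkA χcA EA bA n w) (chainVal TkB χcB EB bB n w))
    (hχA : ∀ k < n, ∀ w, χcA k w ≤ χfA k w)
    (hκA : ∀ k < n, ∀ w, (TkA k).op (fun w => χfA k w * EA k w * chainVal TkA χcA EA bA k w) w ≤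
      ENNReal.ofReal (Real.exp (κA k)) * chainVal TkA χcA EA bA (k + 1) w)
    (hχB : ∀ k < n, ∀ w, χcB k w ≤ χfB k w)
    (hκB : ∀ k < n, ∀ w, (TkB k).op (fun w => χfB k w * EB k w * chainVal TkB χcB EB bB k w) w ≤
      ENNReal.ofReal (Real.exp (κB k)) * chainVal TkB χcB EB bB (k + 1) w) :
    Sandwiched (lo - ∑ k ∈ range n, κA k) (hi + ∑ k ∈ range n, κB k)
      (chainVal TkA χfA EA bA n w) (chainVal TkB χfB EB bB n w) :=
  sandwiched_of_flattened hcore (chain_flatten TkA n hχA hκA w) (chain_flatten TkB n hχB hκB w)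

end Rate

section Weight

/-- **WEIGHT PACKAGING, ONE TERM** (real form after the final integration): `0 ≤ Xcore ≤ X ≤ e^{L}·Xcore` ⇒ the
flattened shell `X − Xcore` is nonnegative, at most the term, and has RELATIVE weight `≤ 1 − e^{−L}` against the FULL
term — the per-term form of the `left` / `right` fields of `T4IndicatorShell.ShellWeightBound`. [folklore] -/
theorem shell_bounds_of_flattened {x₀ x L : ℝ} (h0 : 0 ≤ x₀) (hlo : x₀ ≤ x) (hhi : x ≤ Real.exp L * x₀) :
    0 ≤ x - x₀ ∧ x - x₀ ≤ x ∧ x - x₀ ≤ (1 - Real.exp (-L)) * x := by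
  refine ⟨sub_nonneg.2 hlo, sub_le_self _ h0, ?_⟩
  have h1 : Real.exp (-L) * x ≤ x₀ := by
    rw [Real.exp_neg]
    calc (Real.exp L)⁻¹ * x ≤ (Real.exp L)⁻¹ * (Real.exp L * x₀) :=
          mul_le_mul_of_nonneg_left hhi (inv_nonneg.2 (Real.exp_nonneg _))
      _ = x₀ := by rw [← mul_assoc, inv_mul_cancel₀ (Real.exp_ne_zero _), one_mul]
  linarith

/-- THE FINAL INTEGRATION PRESERVES THE FLATTENING: a pointwise flattened pair of finite nonnegative densities along the
driving field, both with integrable real parts, has integrated weights `0 ≤ ∫core ≤ ∫full ≤ e^{L}·∫core` — the term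
weights `Xcore`, `X` of the hybrid kernel (`T4WeightBudget`: `A K t τ = ∫ F^A_τ`). [folklore] -/
theorem integral_flatten {V : Type*} [MeasurableSpace V] {μ : Measure V} {core full : V → ℝ≥0∞} {L : ℝ}
    (h : ∀ v, Sandwiched 0 L (core v) (full v)) (hc : ∀ v, core v ≠ ∞) (hf : ∀ v, full v ≠ ∞)
    (hic : Integrable (fun v => (core v).toReal) μ) (hif : Integrable (fun v => (full v).toReal) μ) :
    0 ≤ ∫ v, (core v).toReal ∂μ ∧ ∫ v, (core v).toReal ∂μ ≤ ∫ v, (full v).toReal ∂μ ∧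
      ∫ v, (full v).toReal ∂μ ≤ Real.exp L * ∫ v, (core v).toReal ∂μ := by
  refine ⟨integral_nonneg fun v => ENNReal.toReal_nonneg, integral_mono hic hif fun v => ?_, ?_⟩
  · have h1 := ((h v).toReal (hc v) (hf v)).1
    simpa only [Real.exp_zero, one_mul] using h1
  · rw [← integral_const_mul]
    exact integral_mono hif (hic.const_mul _) fun v => ((h v).toReal (hc v) (hf v)).2

variable {ι : Type*} {l₀ vol : ℝ} {T : ℕ → Finset ι} {A B Acore Bcore : ℕ → ℝ → ι → ℝ} {L W δ : ℕ → ℝ}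
  {Bad : ℕ → ℝ → Finset ι}

/-- **THE DICTIONARY: flattened nested shells ⇒ `T4IndicatorShell.ShellWeightBound`.**  Per number of steps `K` a
log-mass `L_K ≥ 0` with `Σ_K L_K < ∞`; per run, per term, on `|t| ≤ l₀`, the flattened bounds
`0 ≤ Xcore ≤ X ≤ e^{L_K}·Xcore` (from §1/§2 and `integral_flatten`).  Then the shell parts `shX := X − Xcore` satisfy
EVERY field of `ShellWeightBound l₀ T A B shA shB Wsh` with `Wsh K := 1 − e^{−L_K}` (summable because `≤ L_K`).
The log-masses themselves are NOT PRINTED and NOT asserted. [folklore] -/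
theorem shellWeightBound_of_flattened (hL0 : ∀ K, 0 ≤ L K) (hLs : Summable L)
    (hA0 : ∀ K t, |t| ≤ l₀ → ∀ τ ∈ T K, 0 ≤ Acore K t τ)
    (hAlo : ∀ K t, |t| ≤ l₀ → ∀ τ ∈ T K, Acore K t τ ≤ A K t τ)
    (hAhi : ∀ K t, |t| ≤ l₀ → ∀ τ ∈ T K, A K t τ ≤ Real.exp (L K) * Acore K t τ)
    (hB0 : ∀ K t, |t| ≤ l₀ → ∀ τ ∈ T K, 0 ≤ Bcore K t τ)
    (hBlo : ∀ K t, |t| ≤ l₀ → ∀ τ ∈ T K, Bcore K t τ ≤ B K t τ)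
    (hBhi : ∀ K t, |t| ≤ l₀ → ∀ τ ∈ T K, B K t τ ≤ Real.exp (L K) * Bcore K t τ) :
    ShellWeightBound l₀ T A B (fun K t τ => A K t τ - Acore K t τ) (fun K t τ => B K t τ - Bcore K t τ)
      (fun K => 1 - Real.exp (-L K)) where
  nonneg K := sub_nonneg.2 (Real.exp_le_one_iff.mpr (neg_nonpos.2 (hL0 K)))
  summable := Summable.of_nonneg_of_le (fun K => sub_nonneg.2 (Real.exp_le_one_iff.mpr (neg_nonpos.2 (hL0 K))))
    (fun K => by linarith [Real.add_one_le_exp (-L K)]) hLs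
  sh_nonneg_left K t ht τ hτ := (shell_bounds_of_flattened (hA0 K t ht τ hτ) (hAlo K t ht τ hτ) (hAhi K t ht τ hτ)).1
  sh_le_left K t ht τ hτ := (shell_bounds_of_flattened (hA0 K t ht τ hτ) (hAlo K t ht τ hτ) (hAhi K t ht τ hτ)).2.1
  sh_nonneg_right K t ht τ hτ :=
    (shell_bounds_of_flattened (hB0 K t ht τ hτ) (hBlo K t ht τ hτ) (hBhi K t ht τ hτ)).1
  sh_le_right K t ht τ hτ := (shell_bounds_of_flattened (hB0 K t ht τ hτ) (hBlo K t ht τ hτ) (hBhi K t ht τ hτ)).2.1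
  left K t ht := by
    rw [Finset.mul_sum]
    exact Finset.sum_le_sum fun τ hτ =>
      (shell_bounds_of_flattened (hA0 K t ht τ hτ) (hAlo K t ht τ hτ) (hAhi K t ht τ hτ)).2.2
  right K t ht := by
    rw [Finset.mul_sum]
    exact Finset.sum_le_sum fun τ hτ =>
      (shell_bounds_of_flattened (hB0 K t ht τ hτ) (hBlo K t ht τ hτ) (hBhi K t ht τ hτ)).2.2

/-- With `shX := X − Xcore` the CORE of the hybrid kernel (`X − shX`) is LITERALLY `Xcore`. [folklore] -/
@[simp] theorem core_eq (X Xcore : ℕ → ℝ → ι → ℝ) (K : ℕ) (t : ℝ) (τ : ι) :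
    X K t τ - (X K t τ - Xcore K t τ) = Xcore K t τ :=
  sub_sub_cancel _ _

/-- **THE `hcore` BINDER BECOMES THE SANDWICH OF THE CORES**: the term-wise half of NE7 asked on the good classes by
`T4IndicatorShell.cauchy_of_relWeightBound_shell` (= the `core` field of `T4MatchingAssembly.HybridNE7`), for the shell
parts `X − Xcore`, is exactly the two-run sandwich of `Acore` against `Bcore` with a `t`-independent constant — the
object rows T4-U5.E-b / T4-U5.E-c sandwich (`T4NestedLevels.goodTerm_sandwich_nested` on the CORE ledgers). [folklore] -/
theorem hcore_of_cores [DecidableEq ι]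
    (h : ∀ K : ℕ, ∃ c : ℝ, ∀ t : ℝ, |t| ≤ l₀ → ∀ τ ∈ T K \ Bad K t,
      Real.exp (c - vol * δ K) * Acore K t τ ≤ Bcore K t τ ∧
        Bcore K t τ ≤ Real.exp (c + vol * δ K) * Acore K t τ) :
    ∀ K : ℕ, ∃ c : ℝ, ∀ t : ℝ, |t| ≤ l₀ → ∀ τ ∈ T K \ Bad K t,
      Real.exp (c - vol * δ K) * (A K t τ - (A K t τ - Acore K t τ)) ≤ B K t τ - (B K t τ - Bcore K t τ) ∧
        B K t τ - (B K t τ - Bcore K t τ) ≤ Real.exp (c + vol * δ K) * (A K t τ - (A K t τ - Acore K t τ)) := by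
  simpa only [sub_sub_cancel] using h

/-- **WEIGHT PACKAGING, END TO END** (CONDITIONAL kernel theorem = `T4IndicatorShell.cauchy_of_relWeightBound_shell` with
the shell slot filled by the flattened nested shells): NE7b's bad-class weights `W` (`RelWeightBound`), the flattened
bounds of both runs with log-masses `L_K`, the weight condition `W K + (1 − e^{−L_K}) < 1`, the dictionary clauses for the
partition functions, positivity, `Σ δ_K < ∞`, and the CORE sandwich on the good classes ⇒ matching modulo constants with
remainders `hybridDelta vol δ (W + (1 − e^{−L}))`, their summability, the Cauchy property and uniform convergence of the
generating functions on `|t| ≤ l₀`.  Every input is a hypothesis; nothing of Bałaban's is asserted. [folklore] -/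
theorem cauchy_of_flattenedShells [DecidableEq ι] {Z : ℕ → ℝ → ℝ} (hvol : 0 < vol) (hl₀ : 0 ≤ l₀)
    (hW : RelWeightBound l₀ T A B Bad W) (hL0 : ∀ K, 0 ≤ L K) (hLs : Summable L)
    (hlt : ∀ K, W K + (1 - Real.exp (-L K)) < 1)
    (hA0 : ∀ K t, |t| ≤ l₀ → ∀ τ ∈ T K, 0 ≤ Acore K t τ)
    (hAlo : ∀ K t, |t| ≤ l₀ → ∀ τ ∈ T K, Acore K t τ ≤ A K t τ)
    (hAhi : ∀ K t, |t| ≤ l₀ → ∀ τ ∈ T K, A K t τ ≤ Real.exp (L K) * Acore K t τ)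
    (hB0 : ∀ K t, |t| ≤ l₀ → ∀ τ ∈ T K, 0 ≤ Bcore K t τ)
    (hBlo : ∀ K t, |t| ≤ l₀ → ∀ τ ∈ T K, Bcore K t τ ≤ B K t τ)
    (hBhi : ∀ K t, |t| ≤ l₀ → ∀ τ ∈ T K, B K t τ ≤ Real.exp (L K) * Bcore K t τ)
    (hZA : ∀ K t, |t| ≤ l₀ → Z K t = ∑ τ ∈ T K, A K t τ)
    (hZB : ∀ K t, |t| ≤ l₀ → Z (K + 1) t = ∑ τ ∈ T K, B K t τ)
    (hpos : ∀ K t, |t| ≤ l₀ → 0 < ∑ τ ∈ T K, A K t τ) (hδ : Summable δ)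
    (hcore : ∀ K : ℕ, ∃ c : ℝ, ∀ t : ℝ, |t| ≤ l₀ → ∀ τ ∈ T K \ Bad K t,
      Real.exp (c - vol * δ K) * Acore K t τ ≤ Bcore K t τ ∧
        Bcore K t τ ≤ Real.exp (c + vol * δ K) * Acore K t τ) :
    MatchingModConstants vol l₀ (hybridDelta vol δ (fun K => W K + (1 - Real.exp (-L K)))) Z ∧
      Summable (hybridDelta vol δ (fun K => W K + (1 - Real.exp (-L K)))) ∧
      (∀ t : ℝ, |t| ≤ l₀ → CauchySeq fun K => genFun Z K t) ∧
      TendstoUniformlyOn (fun K t => genFun Z K t) (genFunLim Z) _root_.Filter.atTop {t | |t| ≤ l₀} :=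
  cauchy_of_relWeightBound_shell hvol hl₀ hW (shellWeightBound_of_flattened hL0 hLs hA0 hAlo hAhi hB0 hBlo hBhi) hlt
    hZA hZB hpos hδ (hcore_of_cores hcore)

/-- CALIBRATION OF THE WEIGHT SLOT: with a bad class of weight `0 ≤ W` and a flattened shell of log-mass `0 ≤ L`
(`Wsh = 1 − e^{−L}`), the hybrid kernel's extra remainder `−log(1 − W − Wsh)` is AT LEAST additive,
`≥ L + (−log(1 − W))` (then divided by `vol` in `T4HybridMatching.hybridDelta`); without a bad class it is EXACTLY `L`
(the tree's `T4WeightBudgetKP.neg_log_one_sub_weightKP`).  The rate packaging charges `L_A + L_B` per term, undivided,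
but needs no `W + Wsh < 1`. [folklore] -/
theorem weightSlot_charge {Wb L : ℝ} (hW : 0 ≤ Wb) (hL : 0 ≤ L) (hlt : Wb + (1 - Real.exp (-L)) < 1) :
    L - Real.log (1 - Wb) ≤ -Real.log (1 - Wb - (1 - Real.exp (-L))) := by
  have he1 : Real.exp (-L) ≤ 1 := Real.exp_le_one_iff.mpr (neg_nonpos.2 hL)
  have hpos : 0 < Real.exp (-L) - Wb := by linarith
  have h1W : 0 < 1 - Wb := by linarith
  have hrw : 1 - Wb - (1 - Real.exp (-L)) = Real.exp (-L) - Wb := by ring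
  have hle : Real.exp (-L) - Wb ≤ Real.exp (-L) * (1 - Wb) := by
    nlinarith [mul_nonneg (sub_nonneg.2 he1) hW]
  have hlog := Real.log_le_log hpos hle
  rw [Real.log_mul (Real.exp_pos _).ne' h1W.ne', Real.log_exp] at hlog
  rw [hrw]
  linarith

end Weight

/-! ## §4 Additive (union-bound) packaging: finitely many single-run shell bounds add (v1.1) -/

section Additive

variable {ι : Type*} {l₀ : ℝ} {T : ℕ → Finset ι} {A B : ℕ → ℝ → ι → ℝ}

/-- **TWO SINGLE-RUN SHELL BOUNDS ADD.**  `(shA₁, shB₁, Wsh₁)` and `(shA₂, shB₂, Wsh₂)` shell bounds for the same two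
runs, and shell parts `shA`, `shB` with `0 ≤ shX ≤ X` and `shX ≤ shX₁ + shX₂` termwise on `|t| ≤ l₀` (the union bound)
⇒ `(shA, shB, Wsh₁ + Wsh₂)` is a shell bound.  Overlaps are over-counted, never under-counted. [folklore] -/
theorem shellWeightBound_add {shA₁ shB₁ shA₂ shB₂ shA shB : ℕ → ℝ → ι → ℝ} {Wsh₁ Wsh₂ : ℕ → ℝ}
    (h₁ : ShellWeightBound l₀ T A B shA₁ shB₁ Wsh₁) (h₂ : ShellWeightBound l₀ T A B shA₂ shB₂ Wsh₂)
    (hA0 : ∀ K t, |t| ≤ l₀ → ∀ τ ∈ T K, 0 ≤ shA K t τ) (hAle : ∀ K t, |t| ≤ l₀ → ∀ τ ∈ T K, shA K t τ ≤ A K t τ)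
    (hAu : ∀ K t, |t| ≤ l₀ → ∀ τ ∈ T K, shA K t τ ≤ shA₁ K t τ + shA₂ K t τ)
    (hB0 : ∀ K t, |t| ≤ l₀ → ∀ τ ∈ T K, 0 ≤ shB K t τ) (hBle : ∀ K t, |t| ≤ l₀ → ∀ τ ∈ T K, shB K t τ ≤ B K t τ)
    (hBu : ∀ K t, |t| ≤ l₀ → ∀ τ ∈ T K, shB K t τ ≤ shB₁ K t τ + shB₂ K t τ) :
    ShellWeightBound l₀ T A B shA shB (fun K => Wsh₁ K + Wsh₂ K) where
  nonneg K := add_nonneg (h₁.nonneg K) (h₂.nonneg K)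
  summable := h₁.summable.add h₂.summable
  sh_nonneg_left := hA0
  sh_le_left := hAle
  sh_nonneg_right := hB0
  sh_le_right := hBle
  left K t ht := by
    calc ∑ τ ∈ T K, shA K t τ ≤ ∑ τ ∈ T K, (shA₁ K t τ + shA₂ K t τ) := sum_le_sum fun τ hτ => hAu K t ht τ hτ
      _ = ∑ τ ∈ T K, shA₁ K t τ + ∑ τ ∈ T K, shA₂ K t τ := sum_add_distrib
      _ ≤ Wsh₁ K * ∑ τ ∈ T K, A K t τ + Wsh₂ K * ∑ τ ∈ T K, A K t τ := add_le_add (h₁.left K t ht) (h₂.left K t ht)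
      _ = (Wsh₁ K + Wsh₂ K) * ∑ τ ∈ T K, A K t τ := by ring
  right K t ht := by
    calc ∑ τ ∈ T K, shB K t τ ≤ ∑ τ ∈ T K, (shB₁ K t τ + shB₂ K t τ) := sum_le_sum fun τ hτ => hBu K t ht τ hτ
      _ = ∑ τ ∈ T K, shB₁ K t τ + ∑ τ ∈ T K, shB₂ K t τ := sum_add_distrib
      _ ≤ Wsh₁ K * ∑ τ ∈ T K, B K t τ + Wsh₂ K * ∑ τ ∈ T K, B K t τ := add_le_add (h₁.right K t ht) (h₂.right K t ht)
      _ = (Wsh₁ K + Wsh₂ K) * ∑ τ ∈ T K, B K t τ := by ring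

/-- **FINITELY MANY SINGLE-RUN SHELL BOUNDS ADD** (the shape named by T4-DAG v6 row T4-U5.E-c-SHELL°): a finite set `S`
of shell-bearing SLOTS (pending levels, or slots of levels), slot `s` carrying its own `ShellWeightBound` with weight
`Wshs s` (its shell piece cut with all OTHER slots full — a piece of the FULL run: single-run species, no circularity, no
run-B object inside a run-A piece), and total shell parts `shA`, `shB` with `0 ≤ shX ≤ X` and `shX ≤ Σ_{s ∈ S} shXs s`
termwise (the union bound) ⇒ the total is a `ShellWeightBound` with weight `K ↦ Σ_{s ∈ S} Wshs s K`; the assembly's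
condition then reads `W K + Σ_s Wshs s K < 1`.  Overlaps of slot shells with each other or with the bad class are
over-counted (valid; a max would only be sharper).  The masses `Wshs` are NOT PRINTED (NE7c species). [folklore] -/
theorem shellWeightBound_of_nestedShells {σ : Type*} (S : Finset σ) {shAs shBs : σ → ℕ → ℝ → ι → ℝ}
    {Wshs : σ → ℕ → ℝ} {shA shB : ℕ → ℝ → ι → ℝ}
    (h : ∀ s ∈ S, ShellWeightBound l₀ T A B (shAs s) (shBs s) (Wshs s))
    (hA0 : ∀ K t, |t| ≤ l₀ → ∀ τ ∈ T K, 0 ≤ shA K t τ) (hAle : ∀ K t, |t| ≤ l₀ → ∀ τ ∈ T K, shA K t τ ≤ A K t τ)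
    (hAu : ∀ K t, |t| ≤ l₀ → ∀ τ ∈ T K, shA K t τ ≤ ∑ s ∈ S, shAs s K t τ)
    (hB0 : ∀ K t, |t| ≤ l₀ → ∀ τ ∈ T K, 0 ≤ shB K t τ) (hBle : ∀ K t, |t| ≤ l₀ → ∀ τ ∈ T K, shB K t τ ≤ B K t τ)
    (hBu : ∀ K t, |t| ≤ l₀ → ∀ τ ∈ T K, shB K t τ ≤ ∑ s ∈ S, shBs s K t τ) :
    ShellWeightBound l₀ T A B shA shB (fun K => ∑ s ∈ S, Wshs s K) where
  nonneg K := sum_nonneg fun s hs => (h s hs).nonneg K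
  summable := summable_sum fun s hs => (h s hs).summable
  sh_nonneg_left := hA0
  sh_le_left := hAle
  sh_nonneg_right := hB0
  sh_le_right := hBle
  left K t ht := by
    calc ∑ τ ∈ T K, shA K t τ ≤ ∑ τ ∈ T K, ∑ s ∈ S, shAs s K t τ := sum_le_sum fun τ hτ => hAu K t ht τ hτ
      _ = ∑ s ∈ S, ∑ τ ∈ T K, shAs s K t τ := sum_comm
      _ ≤ ∑ s ∈ S, Wshs s K * ∑ τ ∈ T K, A K t τ := sum_le_sum fun s hs => (h s hs).left K t ht
      _ = (∑ s ∈ S, Wshs s K) * ∑ τ ∈ T K, A K t τ := by rw [sum_mul]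
  right K t ht := by
    calc ∑ τ ∈ T K, shB K t τ ≤ ∑ τ ∈ T K, ∑ s ∈ S, shBs s K t τ := sum_le_sum fun τ hτ => hBu K t ht τ hτ
      _ = ∑ s ∈ S, ∑ τ ∈ T K, shBs s K t τ := sum_comm
      _ ≤ ∑ s ∈ S, Wshs s K * ∑ τ ∈ T K, B K t τ := sum_le_sum fun s hs => (h s hs).right K t ht
      _ = (∑ s ∈ S, Wshs s K) * ∑ τ ∈ T K, B K t τ := by rw [sum_mul]

/-- FLATTENED MULTIPLICITIES: slots indexed by (level `ℓ ∈ Λ`, copy `i < m ℓ`) with a weight depending on the level only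
sum to `Σ_ℓ m_ℓ · w_ℓ` (the `Σ_ℓ m_ℓ·Wsh_ℓ` of the T4-DAG row; `m_ℓ` = O-c7's flattened multiplicity). [folklore] -/
theorem sum_slots_by_level {lv : Type*} (Λ : Finset lv) (m : lv → ℕ) (w : lv → ℝ) :
    ∑ x ∈ Λ.sigma (fun ℓ => range (m ℓ)), w x.1 = ∑ ℓ ∈ Λ, (m ℓ : ℝ) * w ℓ := by
  rw [sum_sigma]
  refine sum_congr rfl fun ℓ _ => ?_
  show ∑ _i ∈ range (m ℓ), w ℓ = _
  rw [sum_const, card_range, nsmul_eq_mul]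

/-- **THE T4-DAG v6 SHAPE VERBATIM**: per level `ℓ ∈ Λ` with flattened multiplicity `m ℓ`, each of its slots carrying a
shell bound of weight `w ℓ`, and the union bound for the total shell parts ⇒ `ShellWeightBound` with weight
`K ↦ Σ_ℓ m_ℓ · w_ℓ K`, so the assembly's `lt_one` reads `W K + Σ_ℓ m_ℓ w_ℓ K < 1`. [folklore] -/
theorem shellWeightBound_of_levels {lv : Type*} (Λ : Finset lv) (m : lv → ℕ) {w : lv → ℕ → ℝ}
    {shAs shBs : (Σ _ : lv, ℕ) → ℕ → ℝ → ι → ℝ} {shA shB : ℕ → ℝ → ι → ℝ}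
    (h : ∀ x ∈ Λ.sigma (fun ℓ => range (m ℓ)), ShellWeightBound l₀ T A B (shAs x) (shBs x) (w x.1))
    (hA0 : ∀ K t, |t| ≤ l₀ → ∀ τ ∈ T K, 0 ≤ shA K t τ) (hAle : ∀ K t, |t| ≤ l₀ → ∀ τ ∈ T K, shA K t τ ≤ A K t τ)
    (hAu : ∀ K t, |t| ≤ l₀ → ∀ τ ∈ T K, shA K t τ ≤ ∑ x ∈ Λ.sigma (fun ℓ => range (m ℓ)), shAs x K t τ)
    (hB0 : ∀ K t, |t| ≤ l₀ → ∀ τ ∈ T K, 0 ≤ shB K t τ) (hBle : ∀ K t, |t| ≤ l₀ → ∀ τ ∈ T K, shB K t τ ≤ B K t τ)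
    (hBu : ∀ K t, |t| ≤ l₀ → ∀ τ ∈ T K, shB K t τ ≤ ∑ x ∈ Λ.sigma (fun ℓ => range (m ℓ)), shBs x K t τ) :
    ShellWeightBound l₀ T A B shA shB (fun K => ∑ ℓ ∈ Λ, (m ℓ : ℝ) * w ℓ K) := by
  have h0 := shellWeightBound_of_nestedShells (Λ.sigma fun ℓ => range (m ℓ)) (Wshs := fun x => w x.1) h hA0 hAle hAu
    hB0 hBle hBu
  have e : (fun K => ∑ x ∈ Λ.sigma (fun ℓ => range (m ℓ)), (fun x => w x.1) x K) =
      fun K => ∑ ℓ ∈ Λ, (m ℓ : ℝ) * w ℓ K :=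
    funext fun K => sum_slots_by_level Λ m (fun ℓ => w ℓ K)
  rw [← e]
  exact h0

end Additive

end Literature.MathematicalPhysics.QuantumFieldTheory.Balaban1983to89.T4NestedShells

end
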